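import Summits.Ventures.Crystal3D.Bulk.SphPolarBound
import Summits.Ventures.Crystal3D.Bulk.SubtendedAngles
import Literature.Geometry.DiscreteGeometry.SphericalPolygonArea
import HarnessLib

/-!
# The back-path bound, the three-way split of an edge through two chord points, and the edge
# functional of an edge on the cutting circle — bricks (S6/S7) of (d3)

HONEST FRAMING. Part of the venture `Summits/Ventures/Crystal3D` (cell `pub-crystal3d`, phase 2;
seat typer-bulk-2), generic and configuration-free; nothing here mentions GAP(1.26). Three
lemmas used by the main metric theorem of (d3) (`Bulk/HexagonTwoRattlers.lean`, plan
`HOME/lean/hexper/README.md`):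

* **`path_bound`** — a polygonal path `f 0, …, f N` of nonzero vectors whose every piece lies on
  a great circle at height `≥ s` over a unit `z` (`⟪f t, u_t⟫ = ⟪f (t+1), u_t⟫ = 0`, `‖u_t‖ = 1`,
  `s ≤ ⟪z, u_t⟫`, `3/4 ≤ s ≤ 1`) satisfies
  `s · ∠(perpTo z (f 0), perpTo z (f N)) ≤ (1001/1000) · Σ_{t<N} ∠(f t, f (t+1))`
  (polar bound `mul_angle_perpTo_le` piecewise + chain inequality `angle_le_sum_angle`);
* **`angle_split3`** — if `t₁ = α₁ u + β₁ u'`, `t₂ = α₂ u + β₂ u'` with nonnegative coefficients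
  and `α₁ β₂ − α₂ β₁ > 0` then `∠(u,u') = ∠(u,t₁) + ∠(t₁,t₂) + ∠(t₂,u')`;
* **`orient3_edge_on_circle`** — an edge with both endpoints on the circle `ν⊥` has edge
  functional `orient3 (v e) (v (e+1)) x = c · ⟪x, ν⟫` with `c > 0` as soon as some point `q`
  has `orient3 (v e) (v (e+1)) q > 0` and `⟪q, ν⟫ > 0`; `orient3_pair_expand` — the functional of
  the pair `(t₁, t₂)` is `(α₁β₂ − α₂β₁)` times that of `(u, u')`.
-/

noncomputable section

namespace Summit.Ventures.Crystal3D

open Literature.Geometry.DiscreteGeometry Real InnerProductGeometry Finset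
open scoped InnerProductSpace RealInnerProductSpace

/-! ## Part A. The back-path bound -/

/-- Normalising does not change projected angles: `∠(perpTo z (c x), perpTo z y) = ∠(perpTo z x,
perpTo z y)` for `c > 0` (unit `z`). -/
theorem angle_perpTo_smul_left {z x y : EuclideanSpace ℝ (Fin 3)} (hz : ‖z‖ = 1) {c : ℝ}
    (hc : 0 < c) : angle (perpTo z (c • x)) (perpTo z y) = angle (perpTo z x) (perpTo z y) := by
  have : perpTo z (c • x) = c • perpTo z x := by
    rw [perpTo_of_norm_eq_one hz, perpTo_of_norm_eq_one hz, real_inner_smul_right, smul_sub,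
      smul_smul]
  rw [this, angle_smul_left_of_pos _ _ hc]

/-- **Back-path bound.** See the module docstring. -/
theorem path_bound {z : EuclideanSpace ℝ (Fin 3)} (hz : ‖z‖ = 1) {s : ℝ} (hs : 3 / 4 ≤ s)
    (hs1 : s ≤ 1) (f : ℕ → EuclideanSpace ℝ (Fin 3)) (N : ℕ) (hN : 0 < N)
    (hf : ∀ t, t ≤ N → f t ≠ 0)
    (hu : ∀ t, t < N → ∃ u : EuclideanSpace ℝ (Fin 3), ‖u‖ = 1 ∧ s ≤ ⟪z, u⟫ ∧ ⟪f t, u⟫ = 0 ∧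
      ⟪f (t + 1), u⟫ = 0) :
    s * angle (perpTo z (f 0)) (perpTo z (f N)) ≤
      1001 / 1000 * ∑ t ∈ range N, angle (f t) (f (t + 1)) := by
  have hs0 : 0 ≤ s := by linarith
  -- piecewise bound
  have hpiece : ∀ t, t < N → s * angle (perpTo z (f t)) (perpTo z (f (t + 1))) ≤
      1001 / 1000 * angle (f t) (f (t + 1)) := by
    intro t ht
    obtain ⟨u, hu1, hzu, h1, h2⟩ := hu t ht
    have hft := hf t ht.le
    have hft1 := hf (t + 1) (by omega)
    have hn1 : 0 < ‖f t‖ := norm_pos_iff.2 hft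
    have hn2 : 0 < ‖f (t + 1)‖ := norm_pos_iff.2 hft1
    -- normalise
    have h := mul_angle_perpTo_le (m := ‖f t‖⁻¹ • f t) (m' := ‖f (t + 1)‖⁻¹ • f (t + 1)) hz hu1 hs hs1
      hzu (by rw [norm_smul, norm_inv, norm_norm, inv_mul_cancel₀ hn1.ne'])
      (by rw [norm_smul, norm_inv, norm_norm, inv_mul_cancel₀ hn2.ne'])
      (by rw [real_inner_smul_left, h1, mul_zero]) (by rw [real_inner_smul_left, h2, mul_zero])
    rwa [angle_perpTo_smul_left hz (inv_pos.2 hn1), angle_comm,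
      angle_perpTo_smul_left hz (inv_pos.2 hn2), angle_comm, angle_smul_left_of_pos _ _ (inv_pos.2 hn1),
      angle_smul_right_of_pos _ _ (inv_pos.2 hn2)] at h
  -- chain inequality on the projections
  have hchain := angle_le_sum_angle (fun t => perpTo z (f t)) hN
  rw [Nat.Ico_zero_eq_range] at hchain
  have hsum : s * ∑ t ∈ range N, angle (perpTo z (f t)) (perpTo z (f (t + 1))) ≤
      1001 / 1000 * ∑ t ∈ range N, angle (f t) (f (t + 1)) := by
    rw [Finset.mul_sum, Finset.mul_sum]
    exact Finset.sum_le_sum fun t ht => hpiece t (mem_range.1 ht)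
  calc s * angle (perpTo z (f 0)) (perpTo z (f N))
      ≤ s * ∑ t ∈ range N, angle (perpTo z (f t)) (perpTo z (f (t + 1))) :=
        mul_le_mul_of_nonneg_left hchain hs0
    _ ≤ _ := hsum

/-! ## Part B. Splitting an edge at two chord points -/

/-- **Three-way split.** If `t₁ = α₁ u + β₁ u'`, `t₂ = α₂ u + β₂ u'` with `α, β ≥ 0` and
`α₁ β₂ − α₂ β₁ > 0` (so `t₁` comes before `t₂` on the arc from `u` to `u'`), then
`∠(u, u') = ∠(u, t₁) + ∠(t₁, t₂) + ∠(t₂, u')`. -/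
theorem angle_split3 {u u' t₁ t₂ : EuclideanSpace ℝ (Fin 3)} {α₁ β₁ α₂ β₂ : ℝ} (hα₁ : 0 ≤ α₁)
    (hβ₁ : 0 ≤ β₁) (hα₂ : 0 ≤ α₂) (hβ₂ : 0 ≤ β₂) (hdet : 0 < α₁ * β₂ - α₂ * β₁)
    (h₁ : t₁ = α₁ • u + β₁ • u') (h₂ : t₂ = α₂ • u + β₂ • u') (ht₁ : t₁ ≠ 0) (ht₂ : t₂ ≠ 0) :
    angle u u' = angle u t₁ + angle t₁ t₂ + angle t₂ u' := by
  have hα₁pos : 0 < α₁ := by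
    rcases hα₁.lt_or_eq with h | h; · exact h
    · exfalso; rw [← h] at hdet; nlinarith [mul_nonneg hα₂ hβ₁]
  have hβ₂pos : 0 < β₂ := by
    rcases hβ₂.lt_or_eq with h | h; · exact h
    · exfalso; rw [← h] at hdet; nlinarith [mul_nonneg hα₂ hβ₁]
  -- `t₂ ∈ span≥0 {u, u'}`: split `∠(u,u')` at `t₂`
  have hsplit2 : angle u u' = angle u t₂ + angle t₂ u' := by
    apply angle_eq_angle_add_add_angle_add_of_mem_span ht₂
    rw [h₂, Submodule.mem_span_pair]
    exact ⟨⟨α₂, hα₂⟩, ⟨β₂, hβ₂⟩, by rw [NNReal.smul_def, NNReal.smul_def]; rfl⟩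
  -- `t₁ ∈ span≥0 {u, t₂}`: `t₁ = (α₁ − β₁ α₂/β₂) u + (β₁/β₂) t₂`
  have hsplit1 : angle u t₂ = angle u t₁ + angle t₁ t₂ := by
    apply angle_eq_angle_add_add_angle_add_of_mem_span ht₁
    have ht₁' : t₁ = ((α₁ * β₂ - α₂ * β₁) / β₂) • u + (β₁ / β₂) • t₂ := by
      rw [h₁, h₂, smul_add, smul_smul, smul_smul]
      have e1 : (α₁ * β₂ - α₂ * β₁) / β₂ + β₁ / β₂ * α₂ = α₁ := by field_simp; ring
      have e2 : β₁ / β₂ * β₂ = β₁ := by field_simp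
      rw [← add_assoc, ← add_smul, e1, e2]
    rw [ht₁', Submodule.mem_span_pair]
    exact ⟨⟨_, div_nonneg hdet.le hβ₂pos.le⟩, ⟨_, div_nonneg hβ₁ hβ₂pos.le⟩,
      by rw [NNReal.smul_def, NNReal.smul_def]; rfl⟩
  rw [hsplit2, hsplit1]

/-! ## Part C. Edge functionals of edges on the cutting circle -/

/-- **An edge on the circle has functional proportional to `⟪·, ν⟫`.** If `⟪u, ν⟫ = ⟪u', ν⟫ = 0`
and `orient3 u u' q ≠ 0` for some `q`, then for all `x`:
`orient3 u u' x · ⟪q, ν⟫ = orient3 u u' q · ⟪x, ν⟫`. -/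
theorem orient3_edge_on_circle {u u' q ν : EuclideanSpace ℝ (Fin 3)} (hu : ⟪u, ν⟫ = 0)
    (hu' : ⟪u', ν⟫ = 0) (x : EuclideanSpace ℝ (Fin 3)) :
    orient3 u u' x * ⟪q, ν⟫ = orient3 u u' q * ⟪x, ν⟫ := by
  have hexp := orient3_expand u u' q x
  have h := congrArg (fun v => ⟪v, ν⟫) hexp
  simp only [inner_add_left, real_inner_smul_left, hu, hu', mul_zero, zero_add] at h
  linarith

/-- **The functional of a pair of chord points**: for `t₁ = α₁ u + β₁ u'`, `t₂ = α₂ u + β₂ u'`,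
`orient3 t₁ t₂ x = (α₁ β₂ − α₂ β₁) · orient3 u u' x`. -/
theorem orient3_pair_expand {u u' t₁ t₂ : EuclideanSpace ℝ (Fin 3)} {α₁ β₁ α₂ β₂ : ℝ}
    (h₁ : t₁ = α₁ • u + β₁ • u') (h₂ : t₂ = α₂ • u + β₂ • u') (x : EuclideanSpace ℝ (Fin 3)) :
    orient3 t₁ t₂ x = (α₁ * β₂ - α₂ * β₁) * orient3 u u' x := by
  rw [h₁, h₂]
  simp only [orient3_add_left, orient3_smul_left, orient3_add_mid, orient3_smul_mid, orient3_self_left]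
  have : orient3 u' u x = -orient3 u u' x := orient3_swap_left _ _ _
  rw [this]; ring

end Summit.Ventures.Crystal3D

end
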